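import Summits.CriticalPhenomena.PercolationContinuityZ3.Theorems.PercNearOneGluingNoHeavyLowerTailPocketWitnessGlued
import Literature.Probability.Percolation.KozmaNitzanLemma5Slack
import HarnessLib

/-!
# `NoHeavyLowerTail` (stmt-CriticalPhenomena-4575) — Kozma–Nitzan Lemma 5 / Theorem 4 with witness AND additive slack (event forms)

Support file (engine seat `prim-cplus-engine` gen 9, 2026-08-20; `--supports stmt-CriticalPhenomena-4575`).  No definitions, no named
facts, no sorries.  Companion of `…PocketWitnessSlack.lean` (the pocket-level statement).

Kozma–Nitzan's Lemma 5 survives an additive defect (tree: `Literature…KozmaNitzan2024_lemma5_real_slack`, their Lemma 3(i) with its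
`+δ`).  Here it is specialised to the event `{· ↔ b}` and summed over the stars of a one-layer observer:
* `PocketWitness.lemma5_event_slack` — `μ(a ↔ b in {0}ᶜ) ≤ μ(v ↔ b in {0}ᶜ) + δ`, `v ∈ B` ⇒ `μ({a ↔ b} ∩ σ_B) ≤ μ({0 ↔ b} ∩ σ_B) + δ·μ(σ_B)`;
* `PocketWitness.thm4_witness_slack` — one-layer `0 ∉ A`, `a₀ ≠ 0` dominated by every PORT of `0` up to `δ`:
  `μ(a₀ ↔ b, 0 ↔ A) ≤ μ(0 ↔ b, 0 ↔ A) + δ`  (`Σ_B μ(σ_B) = 1`).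
[cite: KozmaNitzan2024, Lemma 3(i) (p. 6), Lemma 5 (p. 13), Thm. 4 (pp. 12–14)]
-/

namespace Summit.CriticalPhenomena.PercolationContinuityZ3.Theorems

open scoped BigOperators Classical
open MeasureTheory Set
open Literature.Probability.LatticeModels (prodBernoulli)
open Literature.Probability.Percolation

namespace PocketWitness

section Slack

variable {V : Type*} [Fintype V]

open KNPreFKG in
/-- **Kozma–Nitzan Lemma 5 with slack, event form.**  `a, v ≠ 0`, `v ∈ B`, `δ ≥ 0`,
`μ(a ↔ b in {0}ᶜ) ≤ μ(v ↔ b in {0}ᶜ) + δ`; then `μ({a ↔ b} ∩ σ_B) ≤ μ({0 ↔ b} ∩ σ_B) + δ·μ(σ_B)`.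
From the tree's real-valued `KozmaNitzan2024_lemma5_real_slack` with `F = 1{b ∈ ·}`.
[cite: KozmaNitzan2024, Lemma 5 (p. 13) with Lemma 3(i) (p. 6)] -/
theorem lemma5_event_slack (w : Sym2 V → unitInterval) (o b a v : V) (B : Set V)
    (hao : a ≠ o) (hvo : v ≠ o) (hvB : v ∈ B) {δ : ℝ} (hδ : 0 ≤ δ)
    (hyp : (prodBernoulli w).real (openConnIn ({o}ᶜ : Set V) a b) ≤
      (prodBernoulli w).real (openConnIn ({o}ᶜ : Set V) v b) + δ) :
    (prodBernoulli w).real (openConn a b ∩ starEvent o B) ≤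
      (prodBernoulli w).real (openConn o b ∩ starEvent o B) + δ * (prodBernoulli w).real (starEvent o B) := by
  set μ := prodBernoulli w with hμ
  set F : Set V → ℝ := fun S => if b ∈ S then 1 else 0 with hF
  have hFmono : ∀ S T : Set V, S ⊆ T → F S ≤ F T := by
    intro S T hST
    by_cases hb : b ∈ S
    · simp [hF, hb, hST hb]
    · by_cases hbT : b ∈ T <;> simp [hF, hb, hbT]
  have hin : ∀ x : V, (fun ω : BondConfig V => F {y | ω ∈ openConnIn ({o}ᶜ : Set V) x y}) =
      (openConnIn ({o}ᶜ : Set V) x b).indicator 1 := by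
    intro x
    funext ω
    by_cases h : ω ∈ openConnIn ({o}ᶜ : Set V) x b
    · simp only [hF, mem_setOf_eq, h, if_true, Set.indicator_of_mem h, Pi.one_apply]
    · simp only [hF, mem_setOf_eq, h, if_false, Set.indicator_of_notMem h]
  have hcl : ∀ x : V, (fun ω : BondConfig V => F (openCluster ω x)) = (openConn x b).indicator 1 := by
    intro x
    funext ω
    have hiff : b ∈ openCluster ω x ↔ ω ∈ (openConn x b : Set (BondConfig V)) := Iff.rfl
    by_cases h : ω ∈ (openConn x b : Set (BondConfig V))
    · simp only [hF, hiff, h, if_true, Set.indicator_of_mem h, Pi.one_apply]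
    · simp only [hF, hiff, h, if_false, Set.indicator_of_notMem h]
  have hyp' : ∫ ω, F {y | ω ∈ openConnIn ({o}ᶜ : Set V) a y} ∂μ ≤
      ∫ ω, F {y | ω ∈ openConnIn ({o}ᶜ : Set V) v y} ∂μ + δ := by
    rw [hin a, hin v, integral_indicator_one MeasurableSet.of_discrete,
      integral_indicator_one MeasurableSet.of_discrete]
    exact hyp
  have key := KozmaNitzan2024_lemma5_real_slack w o a v B F hFmono hao hvo hvB δ hδ hyp'
  have hset : ∀ x : V, ∫ ω in starEvent o B, F (openCluster ω x) ∂μ = μ.real (openConn x b ∩ starEvent o B) := by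
    intro x
    rw [hcl x, integral_indicator_one MeasurableSet.of_discrete, measureReal_restrict_apply MeasurableSet.of_discrete]
  rw [hset a, hset o] at key
  exact key

open KNPreFKG in
/-- **Kozma–Nitzan Theorem 4 with witness AND slack.**  `0 ∉ A` one-layer (`hiso`), `a₀ ≠ 0` any vertex with
`μ(a₀ ↔ b in {0}ᶜ) ≤ μ(p ↔ b in {0}ᶜ) + δ` for every port `p` of `0`; then
`μ(a₀ ↔ b, 0 ↔ A) ≤ μ(0 ↔ b, 0 ↔ A) + δ`.  (Sum of `lemma5_event_slack` over the stars `σ_B`, `Σ_B μ(σ_B) = 1`.)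
[cite: KozmaNitzan2024, Thm. 4 (pp. 12–14), Lemma 5 (p. 13)] -/
theorem thm4_witness_slack (w : Sym2 V → unitInterval) (A : Finset V)
    (o b a₀ : V) (hoA : o ∉ A) (ha₀o : a₀ ≠ o)
    (hiso : ∀ u, u ≠ o → u ∉ A → w s(o, u) = 0) {δ : ℝ} (hδ : 0 ≤ δ)
    (hdom : ∀ p ∈ A, w s(o, p) ≠ 0 →
      (prodBernoulli w).real (openConnIn ({o}ᶜ : Set V) a₀ b) ≤
        (prodBernoulli w).real (openConnIn ({o}ᶜ : Set V) p b) + δ) :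
    (prodBernoulli w).real (openConn a₀ b ∩ ⋃ a' ∈ A, openConn o a') ≤
      (prodBernoulli w).real (openConn o b ∩ ⋃ a' ∈ A, openConn o a') + δ := by
  classical
  set μ := prodBernoulli w with hμ
  set U : Set (BondConfig V) := ⋃ a' ∈ A, openConn o a' with hU
  by_cases hbo : b = o
  · subst hbo
    have h1 : μ.real (openConn a₀ b ∩ U) ≤ μ.real (openConn b b ∩ U) := by
      refine measureReal_mono ?_
      rintro ω ⟨-, hω⟩
      exact ⟨(SimpleGraph.Reachable.refl b : (openGraph ω).Reachable b b), hω⟩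
    linarith
  have hsum : ∑ B ∈ A.powerset, μ.real (starEvent o (↑B : Set V)) = 1 := by
    have h := real_eq_sum_inter_starEvent w A o hoA hiso (Set.univ : Set (BondConfig V))
    simp only [Set.univ_inter, probReal_univ] at h
    exact h.symm
  rw [real_eq_sum_inter_starEvent w A o hoA hiso (openConn a₀ b ∩ U),
    real_eq_sum_inter_starEvent w A o hoA hiso (openConn o b ∩ U)]
  have hterm : ∀ B ∈ A.powerset, μ.real ((openConn a₀ b ∩ U) ∩ starEvent o ↑B) ≤
      μ.real ((openConn o b ∩ U) ∩ starEvent o ↑B) + δ * μ.real (starEvent o (↑B : Set V)) := by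
    intro B hB
    have hBA : B ⊆ A := Finset.mem_powerset.1 hB
    have hnn : 0 ≤ δ * μ.real (starEvent o (↑B : Set V)) := mul_nonneg hδ measureReal_nonneg
    rcases B.eq_empty_or_nonempty with rfl | hBne
    · have h0 : (openConn a₀ b ∩ U) ∩ starEvent o ↑(∅ : Finset V) = (∅ : Set (BondConfig V)) := by
        ext ω
        simp only [hU, mem_inter_iff, mem_iUnion, exists_prop, mem_empty_iff_false, iff_false, not_and]
        rintro ⟨-, a', ha', hoa'⟩ hσ
        rw [Finset.coe_empty] at hσ
        exact not_reachable_of_mem_starEvent_empty hσ (fun h => hoA (h ▸ ha')) hoa'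
      rw [h0, measureReal_empty]
      linarith [measureReal_nonneg (μ := μ) (s := (openConn o b ∩ U) ∩ starEvent o ↑(∅ : Finset V))]
    · by_cases hport : ∃ v ∈ B, w s(o, v) ≠ 0
      · obtain ⟨v, hv, hwv⟩ := hport
        have hvo : v ≠ o := fun h => hoA (h ▸ hBA hv)
        have L5 := lemma5_event_slack w o b a₀ v (↑B) ha₀o hvo (Finset.mem_coe.2 hv) hδ
          (hdom v (hBA hv) hwv)
        have hσU : starEvent o (↑B : Set V) ⊆ U := by
          intro ω hσ
          have hov : s(o, v) ∈ ω := ((mem_starEvent_iff o (↑B) ω).1 hσ v hvo).2 (Finset.mem_coe.2 hv)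
          have hadj : (openGraph ω).Adj o v := (openGraph_adj ω o v).2 ⟨hov, hvo.symm⟩
          rw [hU]
          exact mem_iUnion₂.2 ⟨v, hBA hv, hadj.reachable⟩
        calc μ.real ((openConn a₀ b ∩ U) ∩ starEvent o ↑B)
            ≤ μ.real (openConn a₀ b ∩ starEvent o ↑B) :=
              measureReal_mono fun ω ⟨⟨h1, _⟩, h2⟩ => ⟨h1, h2⟩
          _ ≤ μ.real (openConn o b ∩ starEvent o ↑B) + δ * μ.real (starEvent o (↑B : Set V)) := L5
          _ ≤ μ.real ((openConn o b ∩ U) ∩ starEvent o ↑B) + δ * μ.real (starEvent o (↑B : Set V)) := by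
              have : μ.real (openConn o b ∩ starEvent o ↑B) ≤ μ.real ((openConn o b ∩ U) ∩ starEvent o ↑B) :=
                measureReal_mono fun ω ⟨h1, h2⟩ => ⟨⟨h1, hσU h2⟩, h2⟩
              linarith
      · push Not at hport
        obtain ⟨v, hv⟩ := hBne
        have hvo : v ≠ o := fun h => hoA (h ▸ hBA hv)
        have hnull : μ.real (starEvent o (↑B : Set V)) = 0 := by
          refine le_antisymm ?_ measureReal_nonneg
          calc μ.real (starEvent o (↑B : Set V))
              ≤ μ.real {ω : BondConfig V | s(o, v) ∈ ω} := measureReal_mono fun ω hσ =>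
                  ((mem_starEvent_iff o (↑B) ω).1 hσ v hvo).2 (Finset.mem_coe.2 hv)
            _ = 0 := by
                  rw [hμ, Literature.Probability.LatticeModels.prodBernoulli_real_setOf_mem, hport v hv]
                  rfl
        have h0 : μ.real ((openConn a₀ b ∩ U) ∩ starEvent o ↑B) = 0 :=
          le_antisymm ((measureReal_mono inter_subset_right).trans hnull.le) measureReal_nonneg
        rw [h0]
        linarith [measureReal_nonneg (μ := μ) (s := (openConn o b ∩ U) ∩ starEvent o ↑B)]
  calc ∑ B ∈ A.powerset, μ.real ((openConn a₀ b ∩ U) ∩ starEvent o ↑B)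
      ≤ ∑ B ∈ A.powerset, (μ.real ((openConn o b ∩ U) ∩ starEvent o ↑B) +
          δ * μ.real (starEvent o (↑B : Set V))) := Finset.sum_le_sum hterm
    _ = ∑ B ∈ A.powerset, μ.real ((openConn o b ∩ U) ∩ starEvent o ↑B) +
          δ * ∑ B ∈ A.powerset, μ.real (starEvent o (↑B : Set V)) := by
        rw [Finset.sum_add_distrib, Finset.mul_sum]
    _ = ∑ B ∈ A.powerset, μ.real ((openConn o b ∩ U) ∩ starEvent o ↑B) + δ := by
        rw [hsum, mul_one]

end Slack

end PocketWitness

end Summit.CriticalPhenomena.PercolationContinuityZ3.Theorems
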